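import Summits.Ventures.PercRepro.ProfileGapMonoThresholdWeakAvgSupply

/-!
# PercRepro — THE PER-SET BOUNDS OF THE WEAK AVERAGED STEP AT `(q, t) = (2, 2)` ON A LOOPLESS MATROID
(p5, gen 28; `proofs/P5-GM1.md` §29(b))

The offset-`0` instance of the `(2, 3)` bounds of `ProfileGapMonoThresholdWeakAverageBounds`, with the constants
shifted (`4 → 3`, `5 → 4`, `3 → 2`).  For a rank-`1` set `B` (class `P = clF N B`, `X = E ∖ B`, `m = ρ(X)`,
`κ = #coloops X`, `Y = E ∖ P`, `F = coloops(X) ∖ P`) the demand `#E · [3 ≤ m] m` is paid by the surviving demand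
`(#X − κ) [3 ≤ m] m + κ [3 ≤ m − 1] (m − 1)` of the deletions plus the shares of the up-sets at the threshold `2`:
* a singleton of a class with `≥ 2` points pays up to `2` short when `m ≥ 4` (`point_bound_singleton_big_two`) and
  nothing short when `m = 3` — THE CHANGED LEMMA: with only two points outside the class both are coloops of `E ∖ b`
  (`sdiff_clF_subset_coloops_of_card_le_two`), so `#F = #Y = 2` and the full shares give `4 + 4 κ ≥ 3 + 3 κ` (the
  bound `#F ≥ κ − 1` of the `t = 3` proof is short there);
* a singleton class is the simple case (`point_bound_singleton_small_two`, through `weakAvg_point_arith_two`);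
* a set with `≥ 2` points pays in full (`point_bound_two_le_two`), and the full class `P` pays `2 #P` extra
  (`point_bound_class_two`), which covers the deficits of its singletons.
-/

open scoped Matroid

namespace PercRepro.Cogirth

open Finset ThmH Skew Shadow Profile

variable {α : Type} [DecidableEq α] {N : Matroid α} [N.Finite]

section PointBounds

/-- **The changed lemma**: if `ρ(E∖B) = 3` and at most `2` points lie outside the class, those points are all
coloops of `E ∖ B` (`ρ((E∖B)∖x) ≤ ρ(P∖B) + ρ(Y∖x) ≤ 2`), so `#Y ≤ #{coloops of E ∖ B outside the class}`. -/
theorem sdiff_clF_subset_coloops_of_card_le_two {B : Finset α} (hB : B ∈ Rq N 1) (h3 : rk N (gr N \ B) = 3)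
    (hY : (gr N \ clF N B).card ≤ 2) :
    (gr N \ clF N B).card ≤ ((coloops N (gr N \ B)).filter (fun y => y ∉ clF N B)).card := by
  have hBg : B ⊆ gr N := (mem_Rq.1 hB).1
  have h1 : rk N B = 1 := rk_eq_of_eRk_eq_cq (mem_Rq.1 hB).2
  have hX : gr N \ B ⊆ gr N := sdiff_subset
  have hYr := rk_sdiff_le_rk_sdiff_clF_add_one (N := N) h1 B
  have hYc : rk N (gr N \ clF N B) ≤ (gr N \ clF N B).card := rk_le_card _
  have hY2 : (gr N \ clF N B).card = 2 := by omega
  apply card_le_card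
  intro x hx
  have hxg : x ∈ gr N := (mem_sdiff.1 hx).1
  have hxP : x ∉ clF N B := (mem_sdiff.1 hx).2
  have hxX : x ∈ gr N \ B := mem_sdiff.2 ⟨hxg, fun h => hxP (subset_clF hBg h)⟩
  rw [mem_filter]
  refine ⟨?_, hxP⟩
  apply mem_coloops_of_rk_erase hX hxX
  have hcover : (gr N \ B).erase x ⊆ (clF N B \ B) ∪ (gr N \ clF N B).erase x := by
    intro z hz
    rw [mem_erase, mem_sdiff] at hz
    rw [mem_union, mem_sdiff, mem_erase, mem_sdiff]
    by_cases hzP : z ∈ clF N B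
    · exact Or.inl ⟨hzP, hz.2.2⟩
    · exact Or.inr ⟨hz.1, hz.2.1, hzP⟩
  have hr1 : rk N (clF N B \ B) ≤ 1 := by
    have := rk_mono' (M := N) (sdiff_subset : clF N B \ B ⊆ clF N B)
    rw [rk_clF, h1] at this
    exact this
  have hr2 : rk N ((gr N \ clF N B).erase x) ≤ 1 := by
    have := rk_le_card (M := N) ((gr N \ clF N B).erase x)
    rw [card_erase_of_mem hx, hY2] at this
    exact this
  have hr3 := rk_mono' (M := N) hcover
  have hr4 := rk_union_le (M := N) (clF N B \ B) ((gr N \ clF N B).erase x)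
  have hr5 := rk_le_rk_erase_add_one (M := N) hX hxX
  omega

/-- **The per-point arithmetic at the threshold `2`** (`x = #(E∖b)`, `m = ρ(E∖b)`, `k = #coloops(E∖b)`): the
demand `(x + 1) · [3 ≤ m] m` is paid by the deletion terms `(x − k) · [3 ≤ m] m + k · [3 ≤ m − 1] (m − 1)` plus the
share `[3 ≤ m] · 2x` of the pairs and, at `m = 3`, the share `k (k − 1)` of the coloop deaths; at `m = 3` a rank-`3`
set of `3` elements is all coloops (`k = 3`), otherwise `x ≥ 4`. -/
theorem weakAvg_point_arith_two (x m k : ℕ) (hmx : m ≤ x) (hkx : k ≤ x) (h3 : m = 3 → k = 3 ∨ 4 ≤ x) :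
    (x + 1) * (if 3 ≤ m then m else 0) ≤
      ((x - k) * (if 3 ≤ m then m else 0) + k * (if 3 ≤ m - 1 then m - 1 else 0)) +
        ((if 3 ≤ m then 2 * x else 0) + (if m = 3 then k * (k - 1) else 0)) := by
  by_cases h4 : 4 ≤ m
  · have hA : 3 ≤ m := by omega
    have hB : 3 ≤ m - 1 := by omega
    have hC : m ≠ 3 := by omega
    simp only [if_pos hA, if_pos hB, if_neg hC]
    obtain ⟨d, rfl⟩ : ∃ d, x = k + d := ⟨x - k, by omega⟩
    obtain ⟨e, rfl⟩ : ∃ e, m = e + 1 := ⟨m - 1, by omega⟩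
    rw [Nat.add_sub_cancel_left, Nat.add_sub_cancel]
    nlinarith [hmx, hkx]
  · by_cases hm : m = 3
    · subst hm
      simp only [if_pos (by norm_num : (3 : ℕ) ≤ 3), if_neg (by norm_num : ¬ ((3 : ℕ) ≤ 3 - 1)), if_true]
      rcases h3 rfl with rfl | hx4
      · omega
      · by_cases hk : k ≤ 4
        · interval_cases k <;> omega
        · obtain ⟨d, rfl⟩ : ∃ d, x = k + d := ⟨x - k, by omega⟩
          obtain ⟨e, rfl⟩ : ∃ e, k = e + 1 := ⟨k - 1, by omega⟩
          rw [Nat.add_sub_cancel_left, Nat.add_sub_cancel]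
          nlinarith [hk]
    · have hA : ¬ (3 ≤ m) := by omega
      have hB : ¬ (3 ≤ m - 1) := by omega
      simp only [if_neg hA, if_neg hB, if_neg hm]
      omega

/-- **A singleton of a class with `≥ 2` points, threshold `2`**: its demand is paid by its surviving demand and its
shares, up to `2` when `ρ(E∖b) ≥ 4` and exactly when `ρ(E∖b) = 3`. -/
theorem point_bound_singleton_big_two (hloop : ∀ x ∈ gr N, rk N {x} = 1) {b : α} (hb : b ∈ gr N)
    (hP : 2 ≤ (clF N {b}).card) :
    (gr N).card * (if 3 ≤ rk N (gr N \ {b}) then rk N (gr N \ {b}) else 0) ≤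
      ((gr N \ {b}).card - (coloops N (gr N \ {b})).card) *
          (if 3 ≤ rk N (gr N \ {b}) then rk N (gr N \ {b}) else 0) +
        (coloops N (gr N \ {b})).card *
          (if 3 ≤ rk N (gr N \ {b}) - 1 then rk N (gr N \ {b}) - 1 else 0) +
      (∑ y ∈ gr N \ clF N {b},
        (if ({b} : Finset α).card = 1 ∧ 3 ≤ rk N (gr N \ {y}) then 1 else 2) *
          ((insert y ({b} : Finset α)).card +
            (if rk N (gr N \ insert y {b}) = 2 then (coloops N (gr N \ insert y {b})).card else 0))) +
      (if 4 ≤ rk N (gr N \ {b}) then 2 else 0) := by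
  have hbg : ({b} : Finset α) ⊆ gr N := singleton_subset_iff.2 hb
  have hB : ({b} : Finset α) ∈ Rq N 1 := by
    rw [mem_Rq]
    exact ⟨hbg, eRk_eq_of_rk_eq_cq (hloop b hb)⟩
  have h1 : rk N {b} = 1 := hloop b hb
  have hX : gr N \ {b} ⊆ gr N := sdiff_subset
  have hXc : (gr N \ {b}).card = (gr N).card - 1 := by
    rw [card_sdiff_of_subset hbg, card_singleton]
  have hn1 : 1 ≤ (gr N).card := card_pos.2 ⟨b, hb⟩
  have hnX : (gr N).card = (gr N \ {b}).card + 1 := by omega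
  have hm : rk N (gr N \ {b}) ≤ (gr N \ clF N {b}).card + 1 := by
    have := rk_sdiff_le_rk_sdiff_clF_add_one (N := N) h1 {b}
    have := rk_le_card (M := N) (gr N \ clF N {b})
    omega
  have hκm : (coloops N (gr N \ {b})).card ≤ rk N (gr N \ {b}) := card_coloops_le_rk hX
  have hκX : (coloops N (gr N \ {b})).card ≤ (gr N \ {b}).card := card_le_card (coloops_subset _)
  have hsupply := (sum_h_insert_ge_gen hB 2).trans (supply_ge_sum_h_gen (N := N) {b} 2)
  simp only [show (2 : ℕ) + 1 = 3 from rfl] at hsupply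
  rw [card_singleton] at hsupply
  rw [hnX]
  by_cases h4 : 4 ≤ rk N (gr N \ {b})
  · rw [if_pos (by omega), if_pos (by omega), if_pos h4]
    -- `m + κ ≤ 2 #Y + 2 ≤ supply + 2`
    have hsup2 : (gr N \ clF N {b}).card * (1 + 1) ≤ ∑ y ∈ gr N \ clF N {b},
        (if ({b} : Finset α).card = 1 ∧ 3 ≤ rk N (gr N \ {y}) then 1 else 2) *
          ((insert y ({b} : Finset α)).card +
            (if rk N (gr N \ insert y {b}) = 2 then (coloops N (gr N \ insert y {b})).card else 0)) :=
      le_trans (Nat.le_add_right _ _) hsupply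
    have key := weakAvg_arith_ge_one (gr N \ {b}).card (rk N (gr N \ {b})) (coloops N (gr N \ {b})).card 1
      ((∑ y ∈ gr N \ clF N {b},
        (if ({b} : Finset α).card = 1 ∧ 3 ≤ rk N (gr N \ {y}) then 1 else 2) *
          ((insert y ({b} : Finset α)).card +
            (if rk N (gr N \ insert y {b}) = 2 then (coloops N (gr N \ insert y {b})).card else 0))) + 2)
      (by omega) hκX (by omega)
    omega
  · by_cases h3 : rk N (gr N \ {b}) = 3
    · rw [if_pos (by omega), if_neg (by omega), if_neg h4, h3]
      -- `3 + 3 κ ≤ supply`, with the full shares of the coloops outside the class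
      have hbig := supply_ge_singleton_big_gen hloop hb hP (t := 2) h3
      simp only [show (2 : ℕ) + 1 = 3 from rfl] at hbig
      have hF := card_coloops_sdiff_le_filter_add_one (N := N) hloop h1
      have hY2 : 2 ≤ (gr N \ clF N {b}).card := by omega
      have hYF : (gr N \ clF N {b}).card ≤ 2 →
          (gr N \ clF N {b}).card ≤ ((coloops N (gr N \ {b})).filter (fun y => y ∉ clF N {b})).card :=
        fun h => sdiff_clF_subset_coloops_of_card_le_two hB h3 h
      set Y := (gr N \ clF N {b}).card with hYdef
      set κ := (coloops N (gr N \ {b})).card with hκdef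
      set F := ((coloops N (gr N \ {b})).filter (fun y => y ∉ clF N {b})).card with hFdef
      -- the arithmetic: `3 + 3κ ≤ 2Y + 2κF` with `F + 1 ≥ κ`, `Y ≥ 2`, `(Y ≤ 2 → Y ≤ F)`
      have hcore : 3 + 3 * κ ≤ 2 * Y + 2 * κ * F := by
        rcases Nat.lt_or_ge Y 3 with hY | hY
        · have hF2 : 2 ≤ F := by have := hYF (by omega); omega
          nlinarith [hF2]
        · rcases Nat.lt_or_ge κ 3 with hκ | hκ
          · interval_cases κ <;> omega
          · have h6 : κ * κ ≤ κ * (F + 1) := Nat.mul_le_mul_left κ hF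
            nlinarith [h6, hκ, hY]
      omega
    · rw [if_neg (by omega), if_neg (by omega), if_neg h4]
      omega

/-- **A singleton class, threshold `2`** (`clF N {b} = {b}`): the simple case, through `weakAvg_point_arith_two`. -/
theorem point_bound_singleton_small_two (hloop : ∀ x ∈ gr N, rk N {x} = 1) {b : α} (hb : b ∈ gr N)
    (hP : (clF N {b}).card = 1) :
    (gr N).card * (if 3 ≤ rk N (gr N \ {b}) then rk N (gr N \ {b}) else 0) ≤
      ((gr N \ {b}).card - (coloops N (gr N \ {b})).card) *
          (if 3 ≤ rk N (gr N \ {b}) then rk N (gr N \ {b}) else 0) +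
        (coloops N (gr N \ {b})).card *
          (if 3 ≤ rk N (gr N \ {b}) - 1 then rk N (gr N \ {b}) - 1 else 0) +
      ∑ y ∈ gr N \ clF N {b},
        (if ({b} : Finset α).card = 1 ∧ 3 ≤ rk N (gr N \ {y}) then 1 else 2) *
          ((insert y ({b} : Finset α)).card +
            (if rk N (gr N \ insert y {b}) = 2 then (coloops N (gr N \ insert y {b})).card else 0)) := by
  have hbg : ({b} : Finset α) ⊆ gr N := singleton_subset_iff.2 hb
  have hB : ({b} : Finset α) ∈ Rq N 1 := by
    rw [mem_Rq]
    exact ⟨hbg, eRk_eq_of_rk_eq_cq (hloop b hb)⟩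
  have hX : gr N \ {b} ⊆ gr N := sdiff_subset
  -- the class is `{b}` itself
  have hPeq : clF N {b} = {b} := by
    apply Subset.antisymm _ (subset_clF hbg)
    intro x hx
    have hcard := card_eq_one.1 hP
    obtain ⟨a, ha⟩ := hcard
    have hb' : b ∈ clF N {b} := subset_clF hbg (mem_singleton_self b)
    rw [ha, mem_singleton] at hx hb'
    rw [mem_singleton, hx, hb']
  have hXc : (gr N \ {b}).card = (gr N).card - 1 := by
    rw [card_sdiff_of_subset hbg, card_singleton]
  have hn1 : 1 ≤ (gr N).card := card_pos.2 ⟨b, hb⟩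
  have hnX : (gr N).card = (gr N \ {b}).card + 1 := by omega
  have hmx : rk N (gr N \ {b}) ≤ (gr N \ {b}).card := rk_le_card _
  have hkx : (coloops N (gr N \ {b})).card ≤ (gr N \ {b}).card := card_le_card (coloops_subset _)
  have h3 : rk N (gr N \ {b}) = 3 → (coloops N (gr N \ {b})).card = 3 ∨ 4 ≤ (gr N \ {b}).card := by
    intro h3
    by_cases h4 : 4 ≤ (gr N \ {b}).card
    · exact Or.inr h4
    · left
      have hXc3 : (gr N \ {b}).card = 3 := by omega
      have hK : gr N \ {b} ⊆ coloops N (gr N \ {b}) := by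
        intro z hz
        apply mem_coloops_of_rk_erase hX hz
        have h1 := rk_le_card (M := N) ((gr N \ {b}).erase z)
        rw [card_erase_of_mem hz, hXc3] at h1
        have h2 := rk_le_rk_erase_add_one hX hz
        omega
      have := card_le_card hK
      omega
  have hari := weakAvg_point_arith_two (gr N \ {b}).card (rk N (gr N \ {b})) (coloops N (gr N \ {b})).card
    hmx hkx h3
  -- the supply covers the shares of the arithmetic lemma
  have hsupply := (sum_h_insert_ge_gen hB 2).trans (supply_ge_sum_h_gen (N := N) {b} 2)
  simp only [show (2 : ℕ) + 1 = 3 from rfl] at hsupply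
  rw [card_singleton, hPeq] at hsupply
  have hFeq : (coloops N (gr N \ {b})).filter (fun y => y ∉ ({b} : Finset α)) = coloops N (gr N \ {b}) := by
    apply filter_true_of_mem
    intro y hy
    exact (mem_sdiff.1 (coloops_subset _ hy)).2
  rw [hFeq] at hsupply
  rw [hPeq, hnX]
  have hshare : (if 3 ≤ rk N (gr N \ {b}) then 2 * (gr N \ {b}).card else 0) +
      (if rk N (gr N \ {b}) = 3 then
        (coloops N (gr N \ {b})).card * ((coloops N (gr N \ {b})).card - 1) else 0) ≤
      ∑ y ∈ gr N \ {b},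
        (if ({b} : Finset α).card = 1 ∧ 3 ≤ rk N (gr N \ {y}) then 1 else 2) *
          ((insert y ({b} : Finset α)).card +
            (if rk N (gr N \ insert y {b}) = 2 then (coloops N (gr N \ insert y {b})).card else 0)) := by
    refine le_trans ?_ hsupply
    split_ifs with ha hb3 hb3 <;> first | omega | (rw [Nat.mul_comm ((coloops N (gr N \ {b})).card - 1)]; omega)
  omega

end PointBounds

section TwoLe

/-- `3 k ≤ 2 k² + 1`. -/
theorem three_mul_le_two_mul_sq_add_one (k : ℕ) : 3 * k ≤ 2 * k * k + 1 := by
  rcases k with _ | k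
  · omega
  · nlinarith

/-- **A set with at least two points pays in full, threshold `2`**: its demand is at most its surviving demand plus
its shares. -/
theorem point_bound_two_le_two (hloop : ∀ x ∈ gr N, rk N {x} = 1) {B : Finset α} (hB : B ∈ Rq N 1)
    (h2 : 2 ≤ B.card) :
    (gr N).card * (if 3 ≤ rk N (gr N \ B) then rk N (gr N \ B) else 0) ≤
      ((gr N \ B).card - (coloops N (gr N \ B)).card) *
          (if 3 ≤ rk N (gr N \ B) then rk N (gr N \ B) else 0) +
        (coloops N (gr N \ B)).card *
          (if 3 ≤ rk N (gr N \ B) - 1 then rk N (gr N \ B) - 1 else 0) +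
      ∑ y ∈ gr N \ clF N B,
        (if B.card = 1 ∧ 3 ≤ rk N (gr N \ {y}) then 1 else 2) *
          ((insert y B).card +
            (if rk N (gr N \ insert y B) = 2 then (coloops N (gr N \ insert y B)).card else 0)) := by
  have hBg : B ⊆ gr N := (mem_Rq.1 hB).1
  have h1 : rk N B = 1 := rk_eq_of_eRk_eq_cq (mem_Rq.1 hB).2
  have hX : gr N \ B ⊆ gr N := sdiff_subset
  have hXc : (gr N \ B).card = (gr N).card - B.card := card_sdiff_of_subset hBg
  have hBn : B.card ≤ (gr N).card := card_le_card hBg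
  have hnX : (gr N).card = (gr N \ B).card + B.card := by omega
  have hm : rk N (gr N \ B) ≤ (gr N \ clF N B).card + 1 := by
    have := rk_sdiff_le_rk_sdiff_clF_add_one (N := N) h1 B
    have := rk_le_card (M := N) (gr N \ clF N B)
    omega
  have hκm : (coloops N (gr N \ B)).card ≤ rk N (gr N \ B) := card_coloops_le_rk hX
  have hκX : (coloops N (gr N \ B)).card ≤ (gr N \ B).card := card_le_card (coloops_subset _)
  have hF := card_coloops_sdiff_le_filter_add_one (N := N) hloop h1
  have hsupply := Nat.mul_le_mul_left 2 (sum_h_insert_ge_gen hB 2)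
  rw [supply_eq_two_mul_of_two_le_gen h2 2] at hsupply
  simp only [show (2 : ℕ) + 1 = 3 from rfl] at hsupply
  -- `supply ≥ 2 (#Y (#B + 1) + [m = 3] (κ − 1) #F)`
  set Y := (gr N \ clF N B).card with hYdef
  set κ := (coloops N (gr N \ B)).card with hκdef
  set F := ((coloops N (gr N \ B)).filter (fun y => y ∉ clF N B)).card with hFdef
  set S := ∑ y ∈ gr N \ clF N B,
        (if B.card = 1 ∧ 3 ≤ rk N (gr N \ {y}) then 1 else 2) *
          ((insert y B).card +
            (if rk N (gr N \ insert y B) = 2 then (coloops N (gr N \ insert y B)).card else 0)) with hSdef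
  rw [hnX]
  by_cases h4 : 4 ≤ rk N (gr N \ B)
  · rw [if_pos (by omega), if_pos (by omega)]
    rw [if_neg (by omega)] at hsupply
    apply weakAvg_arith_ge_one _ _ _ _ _ (by omega) hκX
    -- `#B m + κ ≤ (#B + 1)(Y + 1) ≤ 2 Y (#B + 1) ≤ S`
    have hY1 : 1 ≤ Y := by omega
    nlinarith [hsupply, hm, hκm, hY1]
  · by_cases h3 : rk N (gr N \ B) = 3
    · rw [if_pos (by omega), if_neg (by omega), h3]
      rw [if_pos h3] at hsupply
      have hY2 : 2 ≤ Y := by omega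
      -- `3 #B + 3 κ ≤ 2 Y (#B + 1) + 2 (κ − 1) F`
      have hcore : 3 * B.card + 3 * κ ≤ 2 * (Y * (B.card + 1) + (κ - 1) * F) := by
        rcases Nat.eq_zero_or_pos κ with hκ0 | hκpos
        · rw [hκ0]; nlinarith [hY2]
        · obtain ⟨k, hk⟩ : ∃ k, κ = k + 1 := ⟨κ - 1, by omega⟩
          rw [hk, Nat.add_sub_cancel]
          have hkF : k ≤ F := by omega
          have h6 : k * k ≤ k * F := Nat.mul_le_mul_left k hkF
          have h7 := three_mul_le_two_mul_sq_add_one k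
          nlinarith [h6, h7, hY2]
      omega
    · rw [if_neg (by omega), if_neg (by omega)]
      omega

/-- **The full class pays `2 #P` extra, threshold `2`** (`B = clF N B`, `#B ≥ 2`, `ρ(E∖B) ≥ 3`): every coloop of
`E ∖ B` lies outside the class and `ρ(E∖B) ≤ #(E∖B)`. -/
theorem point_bound_class_two {B : Finset α} (hB : B ∈ Rq N 1)
    (h2 : 2 ≤ B.card) (hBP : clF N B = B) (h3 : 3 ≤ rk N (gr N \ B)) :
    (gr N).card * (if 3 ≤ rk N (gr N \ B) then rk N (gr N \ B) else 0) + 2 * B.card ≤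
      ((gr N \ B).card - (coloops N (gr N \ B)).card) *
          (if 3 ≤ rk N (gr N \ B) then rk N (gr N \ B) else 0) +
        (coloops N (gr N \ B)).card *
          (if 3 ≤ rk N (gr N \ B) - 1 then rk N (gr N \ B) - 1 else 0) +
      ∑ y ∈ gr N \ clF N B,
        (if B.card = 1 ∧ 3 ≤ rk N (gr N \ {y}) then 1 else 2) *
          ((insert y B).card +
            (if rk N (gr N \ insert y B) = 2 then (coloops N (gr N \ insert y B)).card else 0)) := by
  have hBg : B ⊆ gr N := (mem_Rq.1 hB).1
  have hX : gr N \ B ⊆ gr N := sdiff_subset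
  have hXc : (gr N \ B).card = (gr N).card - B.card := card_sdiff_of_subset hBg
  have hBn : B.card ≤ (gr N).card := card_le_card hBg
  have hnX : (gr N).card = (gr N \ B).card + B.card := by omega
  have hm : rk N (gr N \ B) ≤ (gr N \ B).card := rk_le_card _
  have hκm : (coloops N (gr N \ B)).card ≤ rk N (gr N \ B) := card_coloops_le_rk hX
  have hκX : (coloops N (gr N \ B)).card ≤ (gr N \ B).card := card_le_card (coloops_subset _)
  have hsupply := Nat.mul_le_mul_left 2 (sum_h_insert_ge_gen hB 2)
  rw [supply_eq_two_mul_of_two_le_gen h2 2] at hsupply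
  simp only [show (2 : ℕ) + 1 = 3 from rfl] at hsupply
  -- with `clF N B = B`: the points outside the class are `E ∖ B`, and every coloop is outside
  have hFeq : (coloops N (gr N \ B)).filter (fun y => y ∉ clF N B) = coloops N (gr N \ B) := by
    apply filter_true_of_mem
    intro y hy
    rw [hBP]
    exact (mem_sdiff.1 (coloops_subset _ hy)).2
  rw [hFeq, hBP] at hsupply
  rw [hBP]
  set X := (gr N \ B).card with hXdef
  set κ := (coloops N (gr N \ B)).card with hκdef
  set S := ∑ y ∈ gr N \ B,
        (if B.card = 1 ∧ 3 ≤ rk N (gr N \ {y}) then 1 else 2) *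
          ((insert y B).card +
            (if rk N (gr N \ insert y B) = 2 then (coloops N (gr N \ insert y B)).card else 0)) with hSdef
  rw [hnX]
  by_cases h4 : 4 ≤ rk N (gr N \ B)
  · rw [if_pos (by omega), if_pos (by omega)]
    rw [if_neg (by omega)] at hsupply
    have key := weakAvg_arith_ge_one X (rk N (gr N \ B)) κ B.card (S - 2 * B.card) (by omega) hκX
      (by
        -- `#B m + κ + 2 #B ≤ #B X + X + 2 #B ≤ 2 X (#B + 1) ≤ S`
        have hX2 : 2 ≤ X := by omega
        have : B.card * rk N (gr N \ B) + κ + 2 * B.card ≤ S := by nlinarith [hsupply, hm, hκm, hX2]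
        omega)
    have hS2 : 2 * B.card ≤ S := by nlinarith [hsupply]
    omega
  · have h3' : rk N (gr N \ B) = 3 := by omega
    rw [if_pos (by omega), if_neg (by omega), h3']
    rw [if_pos h3'] at hsupply
    have hX3 : 3 ≤ X := by omega
    -- `5 #B + 3 κ ≤ 2 X (#B + 1) + 2 (κ − 1) κ`
    have hcore : 3 * B.card + 3 * κ + 2 * B.card ≤ 2 * (X * (B.card + 1) + (κ - 1) * κ) := by
      rcases Nat.lt_or_ge κ 4 with hκ | hκ
      · interval_cases κ <;> nlinarith [hX3]
      · obtain ⟨k, hk⟩ : ∃ k, κ = k + 4 := ⟨κ - 4, by omega⟩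
        have hk3 : k + 4 - 1 = k + 3 := by omega
        rw [hk, hk3]
        nlinarith [hX3]
    omega

end TwoLe

end PercRepro.Cogirth
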